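import Summits.Ventures.CertifiedManyBodySolver.Theorems.TcThermcert1QbpLiebRobinsonLeakage
import Mathlib
import HarnessLib

/-!
# `TcThermcert1` — QBP chain, PART 7c: leakage bounds for a general supported family (seam-augmented dynamics)

PART 7b (`TcThermcert1QbpLiebRobinsonLeakage`) bounds the leakage of a collar-restricted lattice-fermion dynamics for
term families indexed by the bonds and sites of a graph.  The dynamics entering the quasi-adiabatic (QBP) generator of
stub B is `τ^{H_r + sV}`, whose terms are the (restricted) Hubbard terms AND the `s`-scaled seam hoppings
`s(1 − e^{±iφ}) c†c` — a second family living on the seam bonds.  Rather than merging the two families bond by bond,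
this file re-proves the two estimates of PART 7b for a family indexed by an ARBITRARY finite type `ι` with a support map
`supp : ι → Finset Λ` (every support nonempty and of diameter `≤ 1` in the graph, at most `D` supports meeting a given
one) — so that a disjoint-union index `HubbardIdx G ⊕ κ` (Hubbard terms ⊕ seam pairs) is covered directly:
* `fermion_lieb_robinson_supported` (+ `_abs`): `‖[τ_s(A), B]‖ ≤ ‖[A, B]‖ + 2‖A‖ Σ_{Z : supp Z ∩ X ≠ ∅} 2J‖B‖|s|
  e^{2eJD|s| − min_{supp Z} δ}`;
* `norm_commutator_sum_le_of_supported`: only terms meeting the collar fail to commute with the collar algebra;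
* `norm_heisenbergEvolution_sub_restricted_le_of_supported`: full minus collar-restricted dynamics of a collar-supported
  observable, uniformly usable in the QBP parameter `s` (only `sup ‖k Z‖ ≤ J` enters).
Sources: Hastings–Koma, CMP 265 (2006) App. A; Nachtergaele–Sims, CMP 265 (2006) Thm. 1; Bratteli–Robinson II §5.2.2;
Capel–Moscolari–Teufel–Wessel, arXiv:2310.09182, proof of Thm. 14 (input (ii)).  SC in the Hubbard model is NOT proved
by anything here.
-/

noncomputable section

open Matrix Finset
open Literature.MathematicalPhysics.QuantumLattice

namespace Summit.Ventures.CertifiedManyBodySolver.Theorems.TcThermcert1.GaugeQbpFarSeam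

open scoped Matrix.Norms.L2Operator

section Supported

variable {Λ : Type*} [LinearOrder Λ] [Fintype Λ] (G : SimpleGraph Λ) {ι : Type*} [Fintype ι]

/-- **Lieb–Robinson bound for an even finite-range lattice-fermion interaction with prescribed supports.**  Terms `k Z`,
`Z : ι`, Hermitian, even and supported on `supp Z` (nonempty, any two of its sites equal or adjacent), at most `D` supports
meeting a given one, `‖k Z‖ ≤ J`; `A ∈ 𝔄(X)`, `B ∈ 𝔄(Y)`, `δ` vanishing on `Y` and `1`-Lipschitz along edges; `s ≥ 0`.
Then `‖[τ_s(A), B]‖ ≤ ‖[A, B]‖ + 2‖A‖ Σ_{Z : supp Z ∩ X ≠ ∅} 2J‖B‖ s e^{2eJD s − min_{supp Z} δ}` (`lieb_robinson_abstract`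
with the touch relation "supports meet" and graded locality `commute_of_mem_carEvenSubalgebra`). Hastings–Koma, CMP 265
(2006) 781, App. A; Nachtergaele–Sims, CMP 265 (2006) 119, Thm. 1. [cite: HastingsKoma2006, App. A] -/
theorem fermion_lieb_robinson_supported (supp : ι → Finset Λ) (hne : ∀ Z, (supp Z).Nonempty)
    (hadj : ∀ Z {z w : Λ}, z ∈ supp Z → w ∈ supp Z → z = w ∨ G.Adj z w)
    {D : ℕ} (hD : ∀ Z, (Finset.univ.filter fun Z' => ¬ Disjoint (supp Z') (supp Z)).card ≤ D)
    (k : ι → Matrix (Finset (Orb Λ)) (Finset (Orb Λ)) ℂ) (hk : ∀ Z, (k Z).IsHermitian)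
    (hkloc : ∀ Z, k Z ∈ carEvenSubalgebra (orbSet (supp Z)))
    {J : ℝ} (hJ0 : 0 ≤ J) (hJ : ∀ Z, ‖k Z‖ ≤ J)
    {X Y : Finset Λ} {A B : Matrix (Finset (Orb Λ)) (Finset (Orb Λ)) ℂ}
    (hA : A ∈ carSubalgebra (orbSet X)) (hB : B ∈ carSubalgebra (orbSet Y))
    (δ : Λ → ℕ) (hδY : ∀ y ∈ Y, δ y = 0) (hδ : ∀ x y, G.Adj x y → δ x ≤ δ y + 1)
    {s : ℝ} (hs : 0 ≤ s) :
    ‖heisenbergEvolution (∑ Z, k Z) s A * B - B * heisenbergEvolution (∑ Z, k Z) s A‖ ≤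
      ‖A * B - B * A‖ + 2 * ‖A‖ *
        ∑ Z ∈ Finset.univ.filter (fun Z : ι => ¬ Disjoint (supp Z) X),
          2 * J * ‖B‖ * s * Real.exp (Real.exp 1 * (2 * J * D) * s - ((supp Z).inf' (hne Z) δ : ℕ)) := by
  classical
  have hcomm : ∀ (Z : ι) {S : Finset Λ} {M : Matrix (Finset (Orb Λ)) (Finset (Orb Λ)) ℂ},
      M ∈ carSubalgebra (orbSet S) → Disjoint (supp Z) S → Commute (k Z) M :=
    fun Z S M hM hd => commute_of_mem_carEvenSubalgebra (hkloc Z) hM (disjoint_orbSet hd)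
  refine lieb_robinson_abstract k hk (fun Z' Z => ¬ Disjoint (supp Z') (supp Z)) ?_
    hJ0 hJ hD B (fun Z => (supp Z).inf' (hne Z) δ) ?_ ?_ A _ ?_ hs
  · intro Z Z' hZZ'
    rw [not_not] at hZZ'
    exact hcomm Z' ((carEvenSubalgebra_le_carSubalgebra _) (hkloc Z)) hZZ'
  · intro Z hZ
    refine hcomm Z hB (Finset.disjoint_left.2 fun z hzZ hzY => hZ ?_)
    exact Nat.eq_zero_of_le_zero ((Finset.inf'_le δ hzZ).trans (hδY z hzY).le)
  · intro Z Z' hZZ'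
    obtain ⟨w, hwZ', hwZ⟩ := Finset.not_disjoint_iff.1 hZZ'
    obtain ⟨z', hz', hmin⟩ := Finset.exists_mem_eq_inf' (hne Z') δ
    rw [hmin]
    refine (Finset.inf'_le δ hwZ).trans ?_
    rcases hadj Z' hwZ' hz' with h | h
    · rw [h]; exact Nat.le_succ _
    · exact hδ w z' h
  · intro Z hZ
    rw [Finset.mem_filter, not_and, not_not] at hZ
    exact hcomm Z hA (hZ (Finset.mem_univ _))

/-- Two-sided-in-time form of `fermion_lieb_robinson_supported` (apply it to `−k` for `s < 0`).
[cite: HastingsKoma2006, App. A] -/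
theorem fermion_lieb_robinson_supported_abs (supp : ι → Finset Λ) (hne : ∀ Z, (supp Z).Nonempty)
    (hadj : ∀ Z {z w : Λ}, z ∈ supp Z → w ∈ supp Z → z = w ∨ G.Adj z w)
    {D : ℕ} (hD : ∀ Z, (Finset.univ.filter fun Z' => ¬ Disjoint (supp Z') (supp Z)).card ≤ D)
    (k : ι → Matrix (Finset (Orb Λ)) (Finset (Orb Λ)) ℂ) (hk : ∀ Z, (k Z).IsHermitian)
    (hkloc : ∀ Z, k Z ∈ carEvenSubalgebra (orbSet (supp Z)))
    {J : ℝ} (hJ0 : 0 ≤ J) (hJ : ∀ Z, ‖k Z‖ ≤ J)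
    {X Y : Finset Λ} {A B : Matrix (Finset (Orb Λ)) (Finset (Orb Λ)) ℂ}
    (hA : A ∈ carSubalgebra (orbSet X)) (hB : B ∈ carSubalgebra (orbSet Y))
    (δ : Λ → ℕ) (hδY : ∀ y ∈ Y, δ y = 0) (hδ : ∀ x y, G.Adj x y → δ x ≤ δ y + 1) (s : ℝ) :
    ‖heisenbergEvolution (∑ Z, k Z) s A * B - B * heisenbergEvolution (∑ Z, k Z) s A‖ ≤
      ‖A * B - B * A‖ + 2 * ‖A‖ *
        ∑ Z ∈ Finset.univ.filter (fun Z : ι => ¬ Disjoint (supp Z) X),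
          2 * J * ‖B‖ * |s| * Real.exp (Real.exp 1 * (2 * J * D) * |s| - ((supp Z).inf' (hne Z) δ : ℕ)) := by
  rcases le_or_gt 0 s with hs | hs
  · rw [abs_of_nonneg hs]
    exact fermion_lieb_robinson_supported G supp hne hadj hD k hk hkloc hJ0 hJ hA hB δ hδY hδ hs
  · have hneg : heisenbergEvolution (∑ Z, k Z) s A = heisenbergEvolution (∑ Z, -k Z) (-s) A := by
      rw [Finset.sum_neg_distrib, heisenbergEvolution_neg_generator, neg_neg]
    rw [hneg, abs_of_neg hs]
    exact fermion_lieb_robinson_supported G supp hne hadj hD (fun Z => -k Z) (fun Z => (hk Z).neg)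
      (fun Z => neg_mem (hkloc Z)) hJ0 (fun Z => (norm_neg (k Z)).le.trans (hJ Z)) hA hB δ hδY hδ
      (neg_nonneg.2 hs.le)

omit [Fintype ι] in
/-- Only the terms whose support meets `X` fail to commute with `𝔄(X)` (graded commutativity of even elements).
Bratteli–Robinson II §5.2.2. [cite: BratteliRobinsonII1997, §5.2.2] -/
theorem norm_commutator_sum_le_of_supported (supp : ι → Finset Λ)
    (k : ι → Matrix (Finset (Orb Λ)) (Finset (Orb Λ)) ℂ) (hkloc : ∀ Z, k Z ∈ carEvenSubalgebra (orbSet (supp Z)))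
    (T : Finset ι) {X : Finset Λ} {O : Matrix (Finset (Orb Λ)) (Finset (Orb Λ)) ℂ}
    (hO : O ∈ carSubalgebra (orbSet X)) :
    ‖(∑ Z ∈ T, k Z) * O - O * ∑ Z ∈ T, k Z‖ ≤
      ∑ Z ∈ T.filter (fun Z => ¬ Disjoint (supp Z) X), ‖k Z * O - O * k Z‖ := by
  classical
  rw [finset_sum_commutator, ← Finset.sum_filter_add_sum_filter_not T (fun Z => ¬ Disjoint (supp Z) X)]
  refine (norm_add_le _ _).trans ?_
  rw [Finset.sum_eq_zero (s := T.filter fun Z => ¬¬ Disjoint (supp Z) X) ?_, norm_zero, add_zero]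
  · exact norm_sum_le _ _
  · intro Z hZ
    rw [Finset.mem_filter, not_not] at hZ
    rw [(commute_of_mem_carEvenSubalgebra (hkloc Z) hO (disjoint_orbSet hZ.2)).eq, sub_self]

/-- **Leakage of a collar-restricted dynamics, supported-family form.**  With the data of
`fermion_lieb_robinson_supported`, a set `T` of terms supported in the collar `X`, and `V ∈ 𝔄⁺(X_V)`, `X_V ⊆ X`:
`‖τ^{Σ_Z k Z}_t(V) − τ^{Σ_{Z ∈ T} k Z}_t(V)‖ ≤ (Σ_{Z ∉ T, supp Z ∩ X ≠ ∅} (‖[V, k Z]‖ + 2‖V‖ Σ_{Z' : supp Z' ∩ X_V ≠ ∅}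
2J‖k Z‖|t| e^{2eJD|t| − min_{supp Z'} δ_Z})) · |t|` for any levels `δ_Z` vanishing on `supp Z` and `1`-Lipschitz along
edges (Duhamel `norm_heisenbergEvolution_add_sub_le_of_commutator`, locality, and the bound above for the restricted
family `Z ↦ (Z ∈ T ? k Z : 0)`).  The seam-augmented Hubbard dynamics `H_r + sV` is the case `ι = HubbardIdx G ⊕ κ`.
Capel–Moscolari–Teufel–Wessel, arXiv:2310.09182, proof of Thm. 14; Hastings–Koma 2006 App. A. [cite: CapelEtAl2023, Thm. 14] -/
theorem norm_heisenbergEvolution_sub_restricted_le_of_supported [DecidableEq ι] (supp : ι → Finset Λ)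
    (hne : ∀ Z, (supp Z).Nonempty) (hadj : ∀ Z {z w : Λ}, z ∈ supp Z → w ∈ supp Z → z = w ∨ G.Adj z w)
    {D : ℕ} (hD : ∀ Z, (Finset.univ.filter fun Z' => ¬ Disjoint (supp Z') (supp Z)).card ≤ D)
    (k : ι → Matrix (Finset (Orb Λ)) (Finset (Orb Λ)) ℂ) (hk : ∀ Z, (k Z).IsHermitian)
    (hkloc : ∀ Z, k Z ∈ carEvenSubalgebra (orbSet (supp Z)))
    {J : ℝ} (hJ0 : 0 ≤ J) (hJ : ∀ Z, ‖k Z‖ ≤ J)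
    (T : Finset ι) {X : Finset Λ} (hT : ∀ Z ∈ T, supp Z ⊆ X)
    {XV : Finset Λ} (hXV : XV ⊆ X) {V : Matrix (Finset (Orb Λ)) (Finset (Orb Λ)) ℂ}
    (hV : V ∈ carEvenSubalgebra (orbSet XV))
    (δ : ι → Λ → ℕ) (hδ0 : ∀ Z, ∀ y ∈ supp Z, δ Z y = 0) (hδ1 : ∀ Z x y, G.Adj x y → δ Z x ≤ δ Z y + 1) (t : ℝ) :
    ‖heisenbergEvolution (∑ Z, k Z) t V - heisenbergEvolution (∑ Z ∈ T, k Z) t V‖ ≤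
      (∑ Z ∈ Tᶜ.filter (fun Z => ¬ Disjoint (supp Z) X),
        (‖V * k Z - k Z * V‖ + 2 * ‖V‖ *
          ∑ Z' ∈ Finset.univ.filter (fun Z' : ι => ¬ Disjoint (supp Z') XV),
            2 * J * ‖k Z‖ * |t| * Real.exp (Real.exp 1 * (2 * J * D) * |t| - ((supp Z').inf' (hne Z') (δ Z) : ℕ)))) *
        |t| := by
  classical
  set kT : ι → Matrix (Finset (Orb Λ)) (Finset (Orb Λ)) ℂ := fun Z => if Z ∈ T then k Z else 0 with hkT
  have hsumT : ∑ Z, kT Z = ∑ Z ∈ T, k Z := by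
    rw [hkT]
    simp only
    rw [Finset.sum_ite_mem, Finset.univ_inter]
  have hkTh : ∀ Z, (kT Z).IsHermitian := fun Z => by
    simp only [hkT]
    split_ifs
    · exact hk Z
    · exact isHermitian_zero
  have hkTloc : ∀ Z, kT Z ∈ carEvenSubalgebra (orbSet (supp Z)) := fun Z => by
    simp only [hkT]
    split_ifs
    · exact hkloc Z
    · exact zero_mem _
  have hkTn : ∀ Z, ‖kT Z‖ ≤ J := fun Z => by
    simp only [hkT]
    split_ifs
    · exact hJ Z
    · rw [norm_zero]; exact hJ0
  -- the restricted family still has at most `D` supports meeting a given one (same supports)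
  have hKh : (∑ Z ∈ T, k Z).IsHermitian := isHermitian_finset_sum _ fun Z _ => hk Z
  have hWh : (∑ Z ∈ Tᶜ, k Z).IsHermitian := isHermitian_finset_sum _ fun Z _ => hk Z
  have hsplit : ∑ Z, k Z = ∑ Z ∈ T, k Z + ∑ Z ∈ Tᶜ, k Z := (Finset.sum_add_sum_compl T k).symm
  have hKmem : ∑ Z ∈ T, k Z ∈ carEvenSubalgebra (orbSet X) :=
    Subalgebra.sum_mem _ fun Z hZ =>
      carEvenSubalgebra_mono (fun o ho => mem_orbSet.2 (hT Z hZ (mem_orbSet.1 ho))) (hkloc Z)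
  have hVX : V ∈ carEvenSubalgebra (orbSet X) :=
    carEvenSubalgebra_mono (fun o ho => mem_orbSet.2 (hXV (mem_orbSet.1 ho))) hV
  have hOmem : ∀ u : ℝ, heisenbergEvolution (∑ Z ∈ T, k Z) u V ∈ carSubalgebra (orbSet X) := fun u =>
    carEvenSubalgebra_le_carSubalgebra _ (heisenbergEvolution_mem_subalgebra _ hKmem hVX u)
  have hB : ∀ Z, k Z ∈ carSubalgebra (orbSet (supp Z)) := fun Z => carEvenSubalgebra_le_carSubalgebra _ (hkloc Z)
  have hc0 : 0 ≤ Real.exp 1 * (2 * J * D) := by positivity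
  rw [hsplit]
  refine norm_heisenbergEvolution_add_sub_le_of_commutator hKh hWh fun u hu => ?_
  refine (norm_commutator_sum_le_of_supported supp k hkloc Tᶜ (hOmem u)).trans (Finset.sum_le_sum fun Z _ => ?_)
  rw [norm_sub_rev, ← hsumT]
  refine (fermion_lieb_robinson_supported_abs G supp hne hadj hD kT hkTh hkTloc hJ0 hkTn
    (carEvenSubalgebra_le_carSubalgebra _ hV) (hB Z) (δ Z) (hδ0 Z) (hδ1 Z) u).trans ?_
  refine add_le_add le_rfl (mul_le_mul_of_nonneg_left (Finset.sum_le_sum fun Z' _ => ?_) (by positivity))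
  have h1 : 2 * J * ‖k Z‖ * |u| ≤ 2 * J * ‖k Z‖ * |t| := mul_le_mul_of_nonneg_left hu (by positivity)
  have h2 : Real.exp (Real.exp 1 * (2 * J * D) * |u| - ((supp Z').inf' (hne Z') (δ Z) : ℕ)) ≤
      Real.exp (Real.exp 1 * (2 * J * D) * |t| - ((supp Z').inf' (hne Z') (δ Z) : ℕ)) :=
    Real.exp_le_exp.2 (sub_le_sub_right (mul_le_mul_of_nonneg_left hu hc0) _)
  exact mul_le_mul h1 h2 (Real.exp_pos _).le (by positivity)

end Supported

end Summit.Ventures.CertifiedManyBodySolver.Theorems.TcThermcert1.GaugeQbpFarSeam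

end
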